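import Literature.Analysis.FluidPDE.SlabTypeICompactness
import Literature.Analysis.FluidPDE.LocalTypeIScaling
import Literature.Analysis.FluidPDE.BlowupLimitBounds
import HarnessLib

/-!
# The limit of a SEQUENCE of local Type-I ancient solutions: lower semicontinuity of `𝐈` and of `D`
# (tool for stub Z4 `stub_caseOneZoom` of the line `radius_dichotomy`, item `TerminalTrace.TypeITraceScarL3`,
# stmt-NavierStokesRegularity-18385)

Seat nsreg-C26-p1 g5 (cell ns-regularity-ideate), `--supports stmt-NavierStokesRegularity-18385`.

Sequence versions (VERBATIM proofs) of two tree tools written for the zooms of ONE solution: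

* `slab_typeIBound_of_seqLimit` — the tree's `slab_typeIBound_of_zoomLimit` (route RellichScar): if `(v_j, π_j, G_j)`
  are suitable in every `Q_a(0)` with weak gradients and `𝐈(v_j, π_j, G_j; Q_a(0)) ≤ I` for all `a, j`, and
  `v_j → w` in `L³(Q_a)`, `π_j ⇀ ϖ` weakly in `L^{3/2}(Q_a)` with `(w, ϖ)` suitable in every `Q_a`, then `(w, ϖ)` is
  suitable on `ℝ³ × ]-∞, 0[` with a weak gradient `H` and `𝐈(w, ϖ, H; ℝ³ × ]-∞,0[) ≤ 4 I` (lower semicontinuity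
  of `A, C, D, E`: `cknAEss_le_of_tendsto_eLpNorm`, `cknC_le_of_tendsto_eLpNorm`, `cknDOsc_le_of_tendsto_weakly`,
  `cknE_le_of_tendsto_eLpNorm`);
* `cknD_le_of_seqLimit` — the tree's `blowup_cknD_le_apex_of_tendsto`: the plain pressure quantity `D(r; z) ≤ D₀`
  at all apices `z.1 ≤ 0` passes to the weak limit (`setLIntegral_rpow_threeHalves_le_of_tendsto_weakly`).
WHAT THIS IS NOT: 18385 / NS regularity NOT proved. [cite: Seregin2014, §6.6 Prop. 6.20] [cite: AlbrittonBarker2019, §2]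
-/

noncomputable section

set_option linter.dupNamespace false

namespace Summit.NavierStokesRegularity.NavierStokesRegularity.Theorems.TypeITraceScarL3

open MeasureTheory Set Function Filter Topology TopologicalSpace Metric
open Literature.Analysis.FluidPDE
open scoped NNReal ENNReal

set_option maxHeartbeats 1600000 in
/-- **Local Type I bound of the limit of a sequence on the half-space**, `𝐈 ≤ 4 I` (sequence version of the tree's
`slab_typeIBound_of_zoomLimit`; Albritton–Barker 2019, Prop. 2.3 / Seregin–Šverák 2009, Lemma 3.3, the lower
semicontinuity of `A, C, D, E`). [cite: AlbrittonBarker2019, Prop. 2.3] [cite: Seregin2014, §6.6 Prop. 6.20] -/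
theorem slab_typeIBound_of_seqLimit (I : ℝ≥0∞) (hI : I < ⊤)
    {v : ℕ → ℝ → EuclideanSpace ℝ (Fin 3) → EuclideanSpace ℝ (Fin 3)}
    {π : ℕ → ℝ → EuclideanSpace ℝ (Fin 3) → ℝ}
    {G : ℕ → ℝ → EuclideanSpace ℝ (Fin 3) → EuclideanSpace ℝ (Fin 3) →L[ℝ] EuclideanSpace ℝ (Fin 3)}
    (hballv : ∀ j (a : ℝ), 0 < a →
      IsSuitableWeakSolutionInBall a (0 : ℝ × EuclideanSpace ℝ (Fin 3)) (v j) (π j))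
    (hGv : ∀ j (a : ℝ), 0 < a → HasWeakSpatialGradientOn
      (parabolicCylinderOpens a (0 : ℝ × EuclideanSpace ℝ (Fin 3))) (v j) (G j))
    (hbd : ∀ j (a : ℝ), 0 < a →
      typeIBound (parabolicCylinder a (0 : ℝ × EuclideanSpace ℝ (Fin 3))) (v j) (π j) (G j) ≤ I)
    {w : ℝ → EuclideanSpace ℝ (Fin 3) → EuclideanSpace ℝ (Fin 3)}
    {ϖ : ℝ → EuclideanSpace ℝ (Fin 3) → ℝ}
    (hlim : ∀ a : ℝ, 0 < a →
        IsSuitableWeakSolutionInBall a 0 w ϖ ∧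
        MemLp (uncurry w) 3
          (volume.restrict (parabolicCylinder a (0 : ℝ × EuclideanSpace ℝ (Fin 3)))) ∧
        Tendsto (fun j => eLpNorm (uncurry (v j) - uncurry w) 3
            (volume.restrict (parabolicCylinder a (0 : ℝ × EuclideanSpace ℝ (Fin 3)))))
          atTop (𝓝 0) ∧
        (∀ g : ℝ × EuclideanSpace ℝ (Fin 3) → ℝ,
          MemLp g 3 (volume.restrict (parabolicCylinder a (0 : ℝ × EuclideanSpace ℝ (Fin 3)))) →
          Tendsto (fun j => ∫ w' in parabolicCylinder a (0 : ℝ × EuclideanSpace ℝ (Fin 3)),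
              (π j) w'.1 w'.2 * g w')
            atTop (𝓝 (∫ w' in parabolicCylinder a (0 : ℝ × EuclideanSpace ℝ (Fin 3)),
              ϖ w'.1 w'.2 * g w')))) :
    IsSuitableWeakSolutionOn (slab (EuclideanSpace ℝ (Fin 3)) (Iio 0) isOpen_Iio) 1 0 w ϖ ∧
    ∃ H : ℝ → EuclideanSpace ℝ (Fin 3) → EuclideanSpace ℝ (Fin 3) →L[ℝ] EuclideanSpace ℝ (Fin 3),
      HasWeakSpatialGradientOn (slab (EuclideanSpace ℝ (Fin 3)) (Iio 0) isOpen_Iio) w H ∧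
      typeIBound (Iio (0 : ℝ) ×ˢ univ) w ϖ H ≤ 4 * I := by
  have hItop : I ≠ ⊤ := hI.ne
  -- ## suitability on the slab and the weak gradient, by exhaustion
  have hswu : IsSuitableWeakSolutionOn (slab (EuclideanSpace ℝ (Fin 3)) (Iio 0) isOpen_Iio) 1 0 w ϖ :=
    ESSBlowup.isSuitableWeakSolutionOn_halfspace fun a ha => (hlim a ha).1
  set Qn : ℕ → Opens (ℝ × EuclideanSpace ℝ (Fin 3)) :=
    fun n => parabolicCylinderOpens ((n : ℝ) + 1) (0 : ℝ × EuclideanSpace ℝ (Fin 3)) with hQn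
  have hmono : Monotone Qn := fun m n hmn z hz =>
    SuitableCompactness.parabolicCylinder_zero_mono (by positivity) (by simpa using hmn) hz
  have hcov : ∀ K ⊆ ((slab (EuclideanSpace ℝ (Fin 3)) (Iio 0) isOpen_Iio :
      Opens (ℝ × EuclideanSpace ℝ (Fin 3))) : Set (ℝ × EuclideanSpace ℝ (Fin 3))),
      IsCompact K → ∃ n, K ⊆ (Qn n : Set (ℝ × EuclideanSpace ℝ (Fin 3))) := fun K hK hKc =>
    ESSBlowup.exists_subset_parabolicCylinder_of_isCompact hK hKc
  choose Gn hGn hGn2 using fun n : ℕ => (hlim ((n : ℝ) + 1) (by positivity)).1.2.2.1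
  obtain ⟨H, hH, hHae⟩ := exists_hasWeakSpatialGradientOn_of_exhaustion
    (Q := slab (EuclideanSpace ℝ (Fin 3)) (Iio 0) isOpen_Iio) (Qn := Qn) hmono hcov hGn
  refine ⟨hswu, H, hH, ?_⟩
  -- ## `𝐈(w, ϖ, H) ≤ 4 I` by lower semicontinuity of `A, C, D, E` on every admissible ball
  refine typeIBound_le_iff.2 fun r hr z hz => ?_
  -- an exhausting ball `Q₀ = Q(0, n + 1) ⊇ Q(z, r)`
  obtain ⟨n, hn⟩ : ∃ n : ℕ, parabolicCylinder r z ⊆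
      parabolicCylinder ((n : ℝ) + 1) (0 : ℝ × EuclideanSpace ℝ (Fin 3)) := by
    obtain ⟨n, hn⟩ := exists_nat_ge (max (r ^ 2 - z.1) (‖z.2‖ + r))
    refine ⟨n, fun w hw => ?_⟩
    have hw0 : w.1 < 0 := (hz hw).1
    rw [mem_parabolicCylinder] at hw
    rw [SuitableCompactness.mem_parabolicCylinder_zero]
    have h1 : r ^ 2 - z.1 ≤ n := (le_max_left _ _).trans hn
    have h2 : ‖z.2‖ + r ≤ n := (le_max_right _ _).trans hn
    have h3 : (n : ℝ) ≤ ((n : ℝ) + 1) ^ 2 := by nlinarith [n.cast_nonneg (α := ℝ)]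
    refine ⟨⟨by linarith [hw.1.1], hw0⟩, ?_⟩
    calc ‖w.2‖ = ‖(w.2 - z.2) + z.2‖ := by rw [sub_add_cancel]
      _ ≤ ‖w.2 - z.2‖ + ‖z.2‖ := norm_add_le _ _
      _ < r + ‖z.2‖ := by rw [← dist_eq_norm]; linarith [hw.2]
      _ ≤ (n : ℝ) + 1 := by linarith
  set a : ℝ := (n : ℝ) + 1 with ha
  have ha0 : 0 < a := by positivity
  set Q₀ : Set (ℝ × EuclideanSpace ℝ (Fin 3)) :=
    parabolicCylinder a (0 : ℝ × EuclideanSpace ℝ (Fin 3)) with hQ₀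
  have hzQ : parabolicCylinder r z ⊆ Q₀ := hn
  obtain ⟨hballu, hum3, hconv, hweak⟩ := hlim a ha0
  have hleΩ : parabolicCylinderOpens r z ≤
      (slab (EuclideanSpace ℝ (Fin 3)) (Iio 0) isOpen_Iio : Opens (ℝ × EuclideanSpace ℝ (Fin 3))) :=
    fun w hw => hz hw
  -- bounds on the approximants
  have hbdσ : ∀ j, abScaledSum r z (v j) (π j) (G j) ≤ I := fun j =>
    (abScaledSum_le_typeIBound hr hzQ).trans (hbd j a ha0)
  -- weak gradients and measurability of the approximants
  have hwg : ∀ j, HasWeakSpatialGradientOn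
      (parabolicCylinderOpens a (0 : ℝ × EuclideanSpace ℝ (Fin 3))) (v j) (G j) := fun j => hGv j a ha0
  have hvm : ∀ j, AEStronglyMeasurable (uncurry (v j)) (volume.restrict Q₀) := by
    intro j
    have h := (hwg j).locallyIntegrableOn.aestronglyMeasurable
    rw [coe_parabolicCylinderOpens] at h
    exact h
  have hum : AEStronglyMeasurable (uncurry w) (volume.restrict Q₀) := hum3.1
  -- `A`
  have hA : cknAEss r z w ≤ I :=
    cknAEss_le_of_tendsto_eLpNorm hr hzQ hvm hum hconv
      fun j => cknAEss_le_abScaledSum.trans (hbdσ j)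
  -- `C`
  have hC : cknC r z w ≤ I :=
    cknC_le_of_tendsto_eLpNorm hr hzQ hvm hum hconv
      fun j => cknC_le_abScaledSum.trans (hbdσ j)
  -- `D`
  have hqmem : ∀ j, MemLp (uncurry (π j)) (3 / 2) (volume.restrict Q₀) := fun j =>
    (hballv j a ha0).2.2.2
  have hD : cknDOsc r z ϖ ≤ I :=
    cknDOsc_le_of_tendsto_weakly hr hzQ hqmem hballu.2.2.2 hweak
      fun j => cknDOsc_le_abScaledSum.trans (hbdσ j)
  -- `E`
  have hHfin : ∫⁻ w in parabolicCylinder r z, ENNReal.ofReal (frobeniusNormSq (H w.1 w.2)) < ∞ := by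
    have e : ∫⁻ w in parabolicCylinder r z, ENNReal.ofReal (frobeniusNormSq (H w.1 w.2)) =
        ∫⁻ w in parabolicCylinder r z, ENNReal.ofReal (frobeniusNormSq (Gn n w.1 w.2)) := by
      refine setLIntegral_congr_of_ae_imp (isOpen_parabolicCylinder r z).measurableSet hzQ ?_
      filter_upwards [hHae n] with w hw hwS
      have e : H w.1 w.2 = Gn n w.1 w.2 := hw hwS
      rw [e]
    rw [e]
    exact lt_of_le_of_lt (lintegral_mono_set hzQ) (hGn2 n)
  have hE : cknE r z H ≤ I :=
    cknE_le_of_tendsto_eLpNorm hr hzQ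
      (fun j => (hwg j).mono (fun w hw => hzQ hw)) (hH.mono hleΩ) hHfin hconv
      fun j => cknE_le_abScaledSum.trans (hbdσ j)
  calc abScaledSum r z w ϖ H = cknAEss r z w + cknC r z w + cknDOsc r z ϖ + cknE r z H := rfl
    _ ≤ I + I + I + I := add_le_add (add_le_add (add_le_add hA hC) hD) hE
    _ = 4 * I := by ring

/-- **The plain pressure quantity of the limit of a sequence** (sequence version of the tree's
`blowup_cknD_le_apex_of_tendsto`): if `D(r; z)[π_j] ≤ D₀` at every apex `z.1 ≤ 0` and radius `r > 0`, for all `j`,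
and `π_j ⇀ ϖ` weakly in `L^{3/2}(Q_a(0))` for every `a > 0`, then `D(r; z)[ϖ] ≤ D₀` at every such apex (weak lower
semicontinuity, `setLIntegral_rpow_threeHalves_le_of_tendsto_weakly`). [cite: Seregin2014, §6.6 Prop. 6.20] -/
theorem cknD_le_of_seqLimit
    {π : ℕ → ℝ → EuclideanSpace ℝ (Fin 3) → ℝ} {D₀ : ℝ≥0}
    (hπm : ∀ j (a : ℝ), 0 < a → AEStronglyMeasurable (uncurry (π j))
      (volume.restrict (parabolicCylinder a (0 : ℝ × EuclideanSpace ℝ (Fin 3)))))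
    (hD : ∀ j (z : ℝ × EuclideanSpace ℝ (Fin 3)), z.1 ≤ 0 → ∀ r : ℝ, 0 < r → cknD r z (π j) ≤ D₀)
    {ϖ : ℝ → EuclideanSpace ℝ (Fin 3) → ℝ}
    (hϖ : ∀ a : ℝ, 0 < a → MemLp (uncurry ϖ) (3 / 2)
      (volume.restrict (parabolicCylinder a (0 : ℝ × EuclideanSpace ℝ (Fin 3)))))
    (hweak : ∀ a : ℝ, 0 < a → ∀ g : ℝ × EuclideanSpace ℝ (Fin 3) → ℝ,
      MemLp g 3 (volume.restrict (parabolicCylinder a (0 : ℝ × EuclideanSpace ℝ (Fin 3)))) →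
      Tendsto (fun j => ∫ w' in parabolicCylinder a (0 : ℝ × EuclideanSpace ℝ (Fin 3)),
          (π j) w'.1 w'.2 * g w')
        atTop (𝓝 (∫ w' in parabolicCylinder a (0 : ℝ × EuclideanSpace ℝ (Fin 3)), ϖ w'.1 w'.2 * g w')))
    {z : ℝ × EuclideanSpace ℝ (Fin 3)} (hz : z.1 ≤ 0) {r : ℝ} (hr : 0 < r) :
    cknD r z ϖ ≤ D₀ := by
  -- the cylinder `Q(a)` containing `Q_r(z)`
  set a : ℝ := ‖z.2‖ + r + Real.sqrt (r ^ 2 - z.1) + 1 with ha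
  have hapos : 0 < a := by rw [ha]; positivity
  have hsub : parabolicCylinder r z ⊆ parabolicCylinder a (0 : ℝ × EuclideanSpace ℝ (Fin 3)) :=
    parabolicCylinder_subset_origin hz hr
  have hr2 : (ENNReal.ofReal r ^ 2) ≠ 0 := pow_ne_zero _ ((ENNReal.ofReal_pos.2 hr).ne')
  have hr2' : (ENNReal.ofReal r ^ 2) ≠ ∞ := ENNReal.pow_ne_top ENNReal.ofReal_ne_top
  -- the bound for the approximants on `Q_r(z)`
  have hPk : ∀ j, 0 ≤ j → ∫⁻ w' in parabolicCylinder r z, ‖uncurry (π j) w'‖ₑ ^ (3 / 2 : ℝ) ≤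
      ENNReal.ofReal r ^ 2 * D₀ := by
    intro j _
    have h1 := hD j z hz r hr
    rw [cknD] at h1
    exact (ENNReal.inv_mul_le_iff hr2 hr2').1 h1
  have hPm : ∀ j, 0 ≤ j → AEStronglyMeasurable (uncurry (π j))
      (volume.restrict (parabolicCylinder a (0 : ℝ × EuclideanSpace ℝ (Fin 3)))) := fun j _ =>
    hπm j a hapos
  have hweak' : ∀ g : ℝ × EuclideanSpace ℝ (Fin 3) → ℝ,
      MemLp g 3 (volume.restrict (parabolicCylinder a (0 : ℝ × EuclideanSpace ℝ (Fin 3)))) →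
      Tendsto (fun j => ∫ w' in parabolicCylinder a (0 : ℝ × EuclideanSpace ℝ (Fin 3)),
          uncurry (π j) w' * g w')
        atTop (𝓝 (∫ w' in parabolicCylinder a (0 : ℝ × EuclideanSpace ℝ (Fin 3)),
          uncurry ϖ w' * g w')) :=
    fun g hg => hweak a hapos g hg
  have h := setLIntegral_rpow_threeHalves_le_of_tendsto_weakly
    (isOpen_parabolicCylinder r z).measurableSet hsub (hϖ a hapos) hPm hPk hweak'
  rw [cknD]
  exact (ENNReal.inv_mul_le_iff hr2 hr2').2 h

end Summit.NavierStokesRegularity.NavierStokesRegularity.Theorems.TypeITraceScarL3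

end
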